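import Summits.Ventures.PercRepro2.CaseOneMarkMovesT
import Summits.Ventures.PercRepro2.CaseOnePocketMovesAll
import Summits.Ventures.PercRepro2.CaseOneNullEdgeClasses
import Summits.Ventures.PercRepro2.CaseOneNullDelete
import Summits.Ventures.PercRepro2.CaseOneTAnchors
import Summits.Ventures.PercRepro2.CaseOneTAnchorsRoots

/-!
# The six-form calculus: null edges, the `a₂`-edge as a graph move, the moves of the lane, the anchors
(blind cell PercRepro2, p1 g31)

The T-pair crosses a null edge (**`Dt_restrict_null`**, **`Dto_restrict_null`**) and the null new edge
of an extension (**`Dt_ext`**, **`Dto_ext`**) like the Q-pair, so the six forms transfer from `G − e₀`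
to `G` when `p e₀ = 0` (**`sixForms_of_restrict_null`**) and from an extension by a null edge to `G`
(**`sixForms_of_ext`**, **`closedAtT_of_ext`**: every absent-edge face of a six-form closed graph is
six-form closed). With `sixForms_of_a2_edge` this turns the `a₂`-edge rule into a GRAPH move:
**`closedAtT_of_a2_edge_restrict`** — `ClosedAtT a₃` in `G − e₂` gives `ClosedAtT a₃` in `G` for every
edge `e₂ = {a₂, a₃}`. The moves of the lane preserve the six-form closed property
(**`closedAtT_of_moveStepQ`**, **`closedAtT_of_movesQ`**), and **`ClosedAnchorT`** — a mark, a
roots-only vertex, a roots-and-`o` vertex — is six-form closed (**`closedAtT_of_closedAnchorT`**),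
hence **`closedAtT_of_movesQ_closedAnchorT`** and **`closedAtT_of_pocket_at_mark`**. (The marked star
and the uwob gadget, the other two closed anchors of the four-form calculus, are not yet anchors of
the six-form calculus: their T-forms need new certificates, proofs/P1-G31.md.) Own code; standard
axioms.
-/

namespace Summit.Ventures.PercRepro2

namespace CaseOne

universe u

/-! ## The T-pair across a null edge -/

section NullT
variable {V : Type*} {E : Type*} [Fintype E] [DecidableEq E] {R : Type*} [CommRing R]
variable {ends : E → Sym2 V} {e₀ : E} {o a₁ a₂ a₃ b : V}

/-- `P(T)` across a null edge. -/
theorem Dt_restrict_null (p : E → R) (hp0 : p e₀ = 0) :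
    Dt p ends a₁ a₂ a₃ = Dt (restrictW p e₀) (restrictEnds ends e₀) a₁ a₂ a₃ := by
  unfold Dt
  refine prob_restrict_null p hp0 _ _ fun ω hω => ?_
  simp only [Set.mem_inter_iff, Set.mem_compl_iff, mem_connEvent, conn_restrict_closed hω]

/-- `P(T, o ∈ U)` across a null edge. -/
theorem Dto_restrict_null (p : E → R) (hp0 : p e₀ = 0) :
    Dto p ends o a₁ a₂ a₃ = Dto (restrictW p e₀) (restrictEnds ends e₀) o a₁ a₂ a₃ := by
  unfold Dto
  refine prob_restrict_null p hp0 _ _ fun ω hω => ?_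
  simp only [Set.mem_inter_iff, Set.mem_compl_iff, Set.mem_union, mem_connEvent,
    conn_restrict_closed hω]

end NullT

section NullTProps
variable {V : Type*} {E : Type*} [Fintype E] [DecidableEq E] {R : Type*} [CommRing R] [LinearOrder R]
variable {ends : E → Sym2 V} {e₀ : E} {o a₁ a₂ a₃ b : V}

/-- `(ii-T)` in `G − e₀` gives `(ii-T)` in `G` when `p e₀ = 0` (any marking). -/
theorem zSplitIIT_of_restrict_null (p : E → R) (hp0 : p e₀ = 0)
    (h : ZSplitIIT (restrictW p e₀) (restrictEnds ends e₀) o a₁ a₂ a₃ b) :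
    ZSplitIIT p ends o a₁ a₂ a₃ b := by
  unfold ZSplitIIT at h ⊢
  rw [iiExprT_restrict_null p hp0, Dto_restrict_null p hp0, Dt_restrict_null p hp0]
  exact h

/-- `(i-T)` in `G − e₀` gives `(i-T)` in `G` when `p e₀ = 0` (any marking). -/
theorem zSplitIT_of_restrict_null (p : E → R) (hp0 : p e₀ = 0)
    (h : ZSplitIT (restrictW p e₀) (restrictEnds ends e₀) o a₁ a₂ a₃ b) :
    ZSplitIT p ends o a₁ a₂ a₃ b := by
  unfold ZSplitIT at h ⊢
  rw [iExprT_restrict_null p hp0, Dto_restrict_null p hp0, Dt_restrict_null p hp0]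
  exact h

end NullTProps

section NullSix
variable {V : Type*} {E : Type*} [Fintype E] [DecidableEq E] {R : Type*} [Field R] [LinearOrder R]
  [IsStrictOrderedRing R]
variable {ends : E → Sym2 V} {e₀ : E} {o a₁ a₂ a₃ b : V}

omit [IsStrictOrderedRing R] in
/-- **The six forms in `G − e₀` give the six forms in `G` when `p e₀ = 0`** (any marking). -/
theorem sixForms_of_restrict_null (p : E → R) (hp0 : p e₀ = 0)
    (h : SixForms (restrictW p e₀) (restrictEnds ends e₀) o a₁ a₂ a₃ b) :
    SixForms p ends o a₁ a₂ a₃ b := by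
  obtain ⟨hII, hIIQ, hIIT, hI, hIQ, hIT⟩ := h
  exact ⟨zSplitII_of_restrict_null p hp0 hII, zSplitIIQ_of_restrict_null p hp0 hIIQ,
    zSplitIIT_of_restrict_null p hp0 hIIT, zSplitI_of_restrict_null p hp0 hI,
    zSplitIQ_of_restrict_null p hp0 hIQ, zSplitIT_of_restrict_null p hp0 hIT⟩

/-- **The `a₂`-edge rule as a graph move**: `ClosedAtT a₃` in `G − e₂` gives `ClosedAtT a₃` in `G` for
an edge `e₂ = {a₂, a₃}`. -/
theorem closedAtT_of_a2_edge_restrict [Fintype V] [DecidableEq V] {e₂ : E} (he : ends e₂ = s(a₂, a₃))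
    (hc : ClosedAtT (R := R) o a₁ a₂ b {e : E // e ≠ e₂} (restrictEnds ends e₂) a₃) :
    ClosedAtT (R := R) o a₁ a₂ b E ends a₃ := by
  intro p hp
  have hr : restrictW (Function.update p e₂ 0) e₂ = restrictW p e₂ := by
    funext e
    simp only [restrictW, Function.update_of_ne e.2]
  have h6 := hc (restrictW p e₂) (IsProbVec.restrictW hp e₂)
  rw [← hr] at h6
  exact sixForms_of_a2_edge p hp he o b
    (sixForms_of_restrict_null (Function.update p e₂ 0) (Function.update_self e₂ 0 p) h6)

end NullSix

/-! ## The T-pair across the null new edge of an extension -/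

section ExtT
variable {V : Type*} {E : Type*} [Fintype E] [DecidableEq E] {R : Type*} [CommRing R]

/-- `P(T)` across the null new edge. -/
theorem Dt_ext (p : E → R) (ends : E → Sym2 V) (s : Sym2 V) (a₁ a₂ a₃ : V) :
    Dt (extW p) (extEnds ends s) a₁ a₂ a₃ = Dt p ends a₁ a₂ a₃ := by
  unfold Dt
  exact prob_ext p _ _ fun ω => by
    simp only [Set.mem_inter_iff, Set.mem_compl_iff, mem_connEvent_ext]

/-- `P(T, o ∈ U)` across the null new edge. -/
theorem Dto_ext (p : E → R) (ends : E → Sym2 V) (s : Sym2 V) (o a₁ a₂ a₃ : V) :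
    Dto (extW p) (extEnds ends s) o a₁ a₂ a₃ = Dto p ends o a₁ a₂ a₃ := by
  unfold Dto
  exact prob_ext p _ _ fun ω => by
    simp only [Set.mem_inter_iff, Set.mem_union, Set.mem_compl_iff, mem_connEvent_ext]

end ExtT

section ExtTProps
variable {V : Type*} {E : Type*} [Fintype E] [DecidableEq E] {R : Type*} [CommRing R] [LinearOrder R]

/-- `(ii-T)` transfers from the extension to `G`. -/
theorem zSplitIIT_of_ext {p : E → R} {ends : E → Sym2 V} {s : Sym2 V} {o a₁ a₂ a₃ b : V}
    (h : ZSplitIIT (extW p) (extEnds ends s) o a₁ a₂ a₃ b) : ZSplitIIT p ends o a₁ a₂ a₃ b := by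
  unfold ZSplitIIT at h ⊢
  rw [iiExprT_ext, Dto_ext, Dt_ext] at h
  exact h

/-- `(i-T)` transfers from the extension to `G`. -/
theorem zSplitIT_of_ext {p : E → R} {ends : E → Sym2 V} {s : Sym2 V} {o a₁ a₂ a₃ b : V}
    (h : ZSplitIT (extW p) (extEnds ends s) o a₁ a₂ a₃ b) : ZSplitIT p ends o a₁ a₂ a₃ b := by
  unfold ZSplitIT at h ⊢
  rw [iExprT_ext, Dto_ext, Dt_ext] at h
  exact h

end ExtTProps

section ExtSix
variable {V : Type*} {E : Type u} [Fintype E] [DecidableEq E] {R : Type*} [Field R] [LinearOrder R]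
  [IsStrictOrderedRing R]

omit [IsStrictOrderedRing R] in
/-- **The six forms transfer from the extension to `G`.** -/
theorem sixForms_of_ext {p : E → R} {ends : E → Sym2 V} {s : Sym2 V} {o a₁ a₂ a₃ b : V}
    (h : SixForms (extW p) (extEnds ends s) o a₁ a₂ a₃ b) : SixForms p ends o a₁ a₂ a₃ b := by
  obtain ⟨hII, hIIQ, hIIT, hI, hIQ, hIT⟩ := h
  exact ⟨zSplitII_of_ext hII, zSplitIIQ_of_ext hIIQ, zSplitIIT_of_ext hIIT, zSplitI_of_ext hI,
    zSplitIQ_of_ext hIQ, zSplitIT_of_ext hIT⟩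

/-- **Every absent-edge face of a six-form closed graph is six-form closed.** -/
theorem closedAtT_of_ext {ends : E → Sym2 V} {s : Sym2 V} {o a₁ a₂ a₃ b : V}
    (h : ClosedAtT (R := R) o a₁ a₂ b (Option E) (extEnds ends s) a₃) :
    ClosedAtT (R := R) o a₁ a₂ b E ends a₃ :=
  fun p hp => sixForms_of_ext (h (extW p) (isProbVec_extW hp))

end ExtSix

/-! ## The moves of the lane preserve the six-form closed property -/

section MovesQT
variable {V : Type*} {R : Type*} [Field R] [LinearOrder R] [IsStrictOrderedRing R] {o a₁ a₂ b : V}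

/-- One move of the lane preserves the six-form closed property. -/
theorem closedAtT_of_moveStepQ {E' : Type u} [Fintype E'] [DecidableEq E'] {ends' : E' → Sym2 V}
    {v' : V} {E : Type u} [Fintype E] [DecidableEq E] {ends : E → Sym2 V} {v : V}
    (h : MoveStepQ o a₁ a₂ b E' ends' v' E ends v) (hc : ClosedAtT (R := R) o a₁ a₂ b E' ends' v') :
    ClosedAtT (R := R) o a₁ a₂ b E ends v := by
  cases h with
  | move h => exact closedAtT_of_moveStep h hc
  | pocketLeaf =>
    exact closedAtT_of_pocket (by assumption) (by assumption) (by assumption) (by assumption)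
      (by assumption) (by assumption) (by assumption) hc
  | pocket =>
    exact closedAtT_of_pocket' (by assumption) (by assumption) (by assumption) (by assumption)
      (by assumption) (by assumption) (by assumption) hc
  | pair =>
    exact closedAtT_of_pair (by assumption) (by assumption) (by assumption) (by assumption)
      (by assumption) (by assumption) hc

/-- **The six-form closed property is preserved by every sequence of moves of the lane.** -/
theorem closedAtT_of_movesQ {E' : Type u} [Fintype E'] [DecidableEq E'] {ends' : E' → Sym2 V}
    {v' : V} {E : Type u} [Fintype E] [DecidableEq E] {ends : E → Sym2 V} {v : V}
    (h : MovesQ o a₁ a₂ b E' ends' v' E ends v) (hc : ClosedAtT (R := R) o a₁ a₂ b E' ends' v') :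
    ClosedAtT (R := R) o a₁ a₂ b E ends v := by
  induction h with
  | refl => exact hc
  | tail _ hstep ih => exact closedAtT_of_moveStepQ hstep ih

end MovesQT

/-! ## The anchors of the six-form calculus -/

section AnchorsT
variable {V : Type*}

/-- **The closed anchors of the six-form calculus so far**: a mark, a roots-only vertex, a
roots-and-`o` vertex (the marked star and the uwob gadget of `ClosedAnchor` are not yet among them). -/
def ClosedAnchorT (o a₁ a₂ b : V) (E : Type u) (ends : E → Sym2 V) (v : V) : Prop :=
  MarkAnchor o a₁ a₂ b E ends v ∨ RootsOnlyAnchor o a₁ a₂ b E ends v ∨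
    RootsAndOAnchor o a₁ a₂ b E ends v

variable (o a₁ a₂ b : V)

/-- A six-form anchor is a four-form anchor. -/
theorem ClosedAnchor.of_closedAnchorT (E : Type u) (ends : E → Sym2 V) (v : V)
    (h : ClosedAnchorT o a₁ a₂ b E ends v) : ClosedAnchor o a₁ a₂ b E ends v := by
  rcases h with h | h | h
  · exact Or.inl h
  · exact Or.inr (Or.inr (Or.inr (Or.inl h)))
  · exact Or.inr (Or.inr (Or.inr (Or.inr h)))

variable [Fintype V] [DecidableEq V] {R : Type*} [Field R] [LinearOrder R] [IsStrictOrderedRing R]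

/-- **A six-form anchor is six-form closed.** -/
theorem closedAtT_of_closedAnchorT (E : Type u) [Fintype E] [DecidableEq E] (ends : E → Sym2 V)
    (v : V) (h : ClosedAnchorT o a₁ a₂ b E ends v) : ClosedAtT (R := R) o a₁ a₂ b E ends v := by
  rcases h with h | ⟨hroot, h1, h2, hb⟩ | ⟨e₀, he₀, hroot, ho, h1, h2, hb⟩
  · rcases h with rfl | rfl | rfl | rfl
    · exact closedAtT_of_o_eq_a3 a₁ a₂ _ b
    · exact closedAtT_of_a1_eq_a3 o _ a₂ b
    · exact closedAtT_of_a2_eq_a3 o a₁ _ b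
    · exact closedAtT_of_b_eq_a3 o a₁ a₂ _
  · exact closedAtT_of_rootsOnly hroot h1 o hb
  · exact closedAtT_of_rootsAndO he₀ hroot ho h1 h2 hb

/-- **Every instance reachable by moves of the lane from a six-form anchor is six-form closed.** -/
theorem closedAtT_of_movesQ_closedAnchorT {E' : Type u} [Fintype E'] [DecidableEq E']
    {ends' : E' → Sym2 V} {v' : V} (h' : ClosedAnchorT o a₁ a₂ b E' ends' v') {E : Type u} [Fintype E]
    [DecidableEq E] {ends : E → Sym2 V} {v : V} (h : MovesQ o a₁ a₂ b E' ends' v' E ends v) :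
    ClosedAtT (R := R) o a₁ a₂ b E ends v :=
  closedAtT_of_movesQ h (closedAtT_of_closedAnchorT o a₁ a₂ b E' ends' v' h')

/-- **A statement vertex in a mark-free pocket at a mark is six-form closed.** -/
theorem closedAtT_of_pocket_at_mark {E : Type u} [Fintype E] [DecidableEq E] {ends : E → Sym2 V}
    {W : Set V} {x : V} {P : Finset E} {e₀ : E} {a₃ : V} (h : IsPocket ends W x P) (he : e₀ ∈ P)
    (ha : a₃ ∈ W) (ho : o ∉ W) (h1 : a₁ ∉ W) (h2 : a₂ ∉ W) (hb : b ∉ W)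
    (hx : x = o ∨ x = a₁ ∨ x = a₂ ∨ x = b) : ClosedAtT (R := R) o a₁ a₂ b E ends a₃ :=
  closedAtT_of_pocket h he ha ho h1 h2 hb
    (closedAtT_of_closedAnchorT o a₁ a₂ b E (pocketEnds ends P e₀ a₃ x) x (Or.inl hx))

end AnchorsT

end CaseOne

end Summit.Ventures.PercRepro2
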